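import Summits.AnomalousDissipation.AnomalousDissipation.Theorems.LawWindowMeasurability
import Summits.AnomalousDissipation.AnomalousDissipation.Theorems.SoloBlindErgodicRealisationMean
import Summits.AnomalousDissipation.AnomalousDissipation.Theses.LoudWindows
import Summits.AnomalousDissipation.AnomalousDissipation.Theses.LionsToll
import HarnessLib

/-!
# `LawRealisation` (routes `LoudWindows`, `LionsToll`; item stmt-AnomalousDissipation-26823) holds

The crux `Summit.AnomalousDissipation.AnomalousDissipation.Theses.LoudWindows.LawRealisation`
(character-for-character also `…Theses.LionsToll.LawRealisation`): for every smooth steady force `f`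
and budgets `E`, `δ > 0` there are `ν`-free constants `C`, `δ' > 0` such that, at every `ν > 0`, every
stationary Leray–Hopf trajectory law (`Torus.IsStationaryLerayHopfLaw ν f P S traj`) with slice second
moment `∫⁻ ofReal ‖traj ω 0‖₂² dP ≤ ofReal E` and mean unit-window dissipation
`ofReal δ ≤ ofReal ν · ∫⁻ (∫⁻_{(0,1)} ‖∇ traj ω‖₂²) dP` has ONE path `ω` with
`meanEnergy (traj ω) ≤ C` and `δ' ≤ meanDissipation ν (traj ω)`.

Proof. The realisation engine is the tree theorem `Theorems.exists_witnessPath_of_meanEnsemble`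
(Birkhoff in conditional-expectation form for the two unit-window functionals, the pathwise Leray–Hopf
bound `d* ≤ ‖f‖₂ √e*`, Chebyshev selection), which asks for the Bochner unit-window energy / dissipation
functionals to be `P`-integrable with mean energy `≤ E₁` and mean dissipation `≥ δ`. Measurability from
`measurable_pairing` alone is `Theorems/LawWindowMeasurability.lean`; this file adds

* the `ν`-UNIFORM window bounds along every Leray–Hopf path (energy inequality from `0` and
  Cauchy–Schwarz/Jensen, `Torus.IsGlobalLerayHopf.abs_timeMean_power_le`):
  `∫₀¹ ‖u‖₂² ≤ 2‖u(0)‖₂² + 4‖f‖₂²` (`lhPath_windowEnergy_le`) and `∫₀¹ ν‖∇u‖₂² ≤ 2‖u(0)‖₂² + 3‖f‖₂²`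
  (`lhPath_windowDissipation_le`) — the tree's `timeMean_norm_sq_le` has `ν⁻¹`-constants and would not do;
* integrability of both window functionals under the slice cap, mean energy `≤ E₁ = 2 max(E,0) + 4‖f‖₂²`;
* the conversion of the `ℝ≥0∞` dissipation floor into the Bochner mean `≥ δ` (pathwise finiteness
  `Torus.IsLerayHopfOn.lintegral_eGradNormSq_lt_top`).

Constants of the conclusion: `C = 16‖f‖₂² E₁²/δ²`, `δ' = δ/2`.

Decomposition cell `decomp-ad`, lens-3 lineage g61 (node ErgodicDictionary g3, item 26823 «CLAIMABLE NOW»;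
RE-ID of the solo-blind programme's realisation theorem as the engine of this dictionary item).

[folklore] [cite: FoiasManleyRosaTemam2001, Ch. IV §3] [cite: DoeringFoias2002, §2]
-/

open MeasureTheory Filter Topology Set Function UnitAddTorus
open scoped ENNReal NNReal RealInnerProductSpace

noncomputable section

-- `Summit.<Summit>.<Problem>` repeats the summit = sub-problem segment (D-0017); line added at landing (census g17, writer NIT l.2012)
set_option linter.dupNamespace false

namespace Summit.AnomalousDissipation.AnomalousDissipation.Theorems

open Literature.Analysis.FunctionSpaces Literature.Analysis.FunctionSpaces.Torus
open Literature.Analysis.FluidPDE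

namespace LawRealisation

/-! ### `ν`-uniform unit-window bounds along one Leray–Hopf path -/

section Path

variable {ν : ℝ} {f u₀ : UnitAddTorus (Fin 3) → EuclideanSpace ℝ (Fin 3)}
  {u : ℝ → UnitAddTorus (Fin 3) → EuclideanSpace ℝ (Fin 3)}

/-- **Unit-window energy bound, uniform in `ν ≥ 0`**: along a global Leray–Hopf solution of `NS_ν(f)`
(`f` smooth, steady), `∫₀¹ ‖u(t)‖₂² dt ≤ 2‖u₀‖₂² + 4‖f‖₂²`. From the energy inequality from `0`,
`½‖u(t)‖₂² ≤ ½‖u₀‖₂² + ∫₀ᵗ ⟨f, u⟩ ≤ ½‖u₀‖₂² + ‖f‖₂ (∫₀¹‖u‖₂²)^{1/2}` (Cauchy–Schwarz/Jensen,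
`abs_timeMean_power_le`), integrated over `t ∈ [0, 1]`. [cite: DoeringFoias2002, §2] -/
theorem lhPath_windowEnergy_le (hu : Torus.IsGlobalLerayHopf ν (fun _ => f) u₀ u) (hν : 0 ≤ ν)
    (hf : IsSmooth f) :
    ∫ t in (0 : ℝ)..1, ∫ x, ‖u t x‖ ^ 2 ≤ 2 * (∫ x, ‖u₀ x‖ ^ 2) + 4 * ∫ x, ‖f x‖ ^ 2 := by
  set e : ℝ → ℝ := fun t => ∫ x, ‖u t x‖ ^ 2 with he
  set I : ℝ := ∫ t in (0 : ℝ)..1, e t with hI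
  set F : ℝ := Real.sqrt (∫ x, ‖f x‖ ^ 2) with hF
  have hF0 : 0 ≤ F := Real.sqrt_nonneg _
  have hF2 : F ^ 2 = ∫ x, ‖f x‖ ^ 2 := Real.sq_sqrt (integral_nonneg fun _ => by positivity)
  have hm0 : 0 ≤ ∫ x, ‖u₀ x‖ ^ 2 := integral_nonneg fun _ => by positivity
  have he0 : ∀ t, 0 ≤ e t := fun t => integral_nonneg fun _ => by positivity
  have heint : IntervalIntegrable e volume 0 1 :=
    lhPath_intervalIntegrable_energy hu le_rfl zero_le_one
  have hI0 : 0 ≤ I := intervalIntegral.integral_nonneg zero_le_one fun t _ => he0 t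
  have hmono : ∀ t ∈ Icc (0 : ℝ) 1, ∫ s in (0 : ℝ)..t, e s ≤ I := fun t ht =>
    intervalIntegral.integral_mono_interval le_rfl ht.1 ht.2 (ae_of_all _ fun s => he0 s) heint
  -- slice bound `‖u(t)‖₂² ≤ ‖u₀‖₂² + 2 F √I` on `[0, 1]`
  have hslice : ∀ t ∈ Icc (0 : ℝ) 1, e t ≤ (∫ x, ‖u₀ x‖ ^ 2) + 2 * F * Real.sqrt I := by
    intro t ht
    have hen := (hu 1 one_pos).energy_ineq_zero t ht
    dsimp only [kineticEnergy] at hen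
    have hD : 0 ≤ ν * (∫⁻ τ in Ioo 0 t, eGradNormSq (u τ)).toReal :=
      mul_nonneg hν ENNReal.toReal_nonneg
    have hP : ∫ τ in (0 : ℝ)..t, ∫ x, ⟪f x, u τ x⟫ ≤ F * Real.sqrt I := by
      rcases ht.1.eq_or_lt with h0 | hpos
      · rw [← h0, intervalIntegral.integral_same]; positivity
      · have hcs := hu.abs_timeMean_power_le hf hpos
        have htm : ∫ τ in (0 : ℝ)..t, ∫ x, ⟪f x, u τ x⟫ =
            t * timeMean (fun τ => ∫ x, ⟪f x, u τ x⟫) t := by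
          unfold timeMean; rw [← mul_assoc, mul_inv_cancel₀ hpos.ne', one_mul]
        have hte : timeMean e t = t⁻¹ * ∫ s in (0 : ℝ)..t, e s := rfl
        have hX0 : 0 ≤ ∫ s in (0 : ℝ)..t, e s :=
          intervalIntegral.integral_nonneg hpos.le fun s _ => he0 s
        have h2 : t * Real.sqrt (timeMean e t) = Real.sqrt (t * ∫ s in (0 : ℝ)..t, e s) := by
          rw [hte, Real.sqrt_mul' _ hX0, Real.sqrt_mul' _ hX0, Real.sqrt_inv, ← mul_assoc]
          congr 1
          rw [mul_inv_eq_iff_eq_mul₀ (Real.sqrt_pos.mpr hpos).ne', Real.mul_self_sqrt hpos.le]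
        have h3 : Real.sqrt (t * ∫ s in (0 : ℝ)..t, e s) ≤ Real.sqrt I :=
          Real.sqrt_le_sqrt (by nlinarith [hmono t ht, ht.1, ht.2])
        calc ∫ τ in (0 : ℝ)..t, ∫ x, ⟪f x, u τ x⟫
            = t * timeMean (fun τ => ∫ x, ⟪f x, u τ x⟫) t := htm
          _ ≤ t * |timeMean (fun τ => ∫ x, ⟪f x, u τ x⟫) t| :=
              mul_le_mul_of_nonneg_left (le_abs_self _) hpos.le
          _ ≤ t * (F * Real.sqrt (timeMean e t)) := mul_le_mul_of_nonneg_left hcs hpos.le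
          _ = F * (t * Real.sqrt (timeMean e t)) := by ring
          _ ≤ F * Real.sqrt I := by rw [h2]; exact mul_le_mul_of_nonneg_left h3 hF0
    have : e t = ∫ x, ‖u t x‖ ^ 2 := rfl
    linarith
  -- integrate over `[0, 1]` and absorb
  have hI1 : I ≤ (∫ x, ‖u₀ x‖ ^ 2) + 2 * F * Real.sqrt I := by
    have h := intervalIntegral.integral_mono_on zero_le_one heint intervalIntegrable_const hslice
    rwa [intervalIntegral.integral_const, sub_zero, one_smul] at h
  rw [← hF2]
  nlinarith [sq_nonneg (2 * F - Real.sqrt I), Real.sq_sqrt hI0, Real.sqrt_nonneg I]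

/-- **Unit-window dissipation bound, uniform in `ν ≥ 0`**: `∫₀¹ ν‖∇u‖₂² ≤ 2‖u₀‖₂² + 3‖f‖₂²` along a
global Leray–Hopf solution (`lhPath_timeMean_dissipation_le` at `T = 1` and
`lhPath_windowEnergy_le`). [cite: DoeringFoias2002, §2] -/
theorem lhPath_windowDissipation_le (hu : Torus.IsGlobalLerayHopf ν (fun _ => f) u₀ u) (hν : 0 ≤ ν)
    (hf : IsSmooth f) :
    ∫ t in (0 : ℝ)..1, ν * (eGradNormSq (u t)).toReal ≤
      2 * (∫ x, ‖u₀ x‖ ^ 2) + 3 * ∫ x, ‖f x‖ ^ 2 := by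
  have h := lhPath_timeMean_dissipation_le hu hf one_pos
  have ht1 : ∀ g : ℝ → ℝ, timeMean g 1 = ∫ t in (0 : ℝ)..1, g t := fun g => by
    unfold timeMean; rw [inv_one, one_mul]
  rw [ht1, ht1, div_one] at h
  dsimp only [kineticEnergy] at h
  have hI := lhPath_windowEnergy_le hu hν hf
  set I : ℝ := ∫ t in (0 : ℝ)..1, ∫ x, ‖u t x‖ ^ 2 with hIdef
  set F : ℝ := Real.sqrt (∫ x, ‖f x‖ ^ 2) with hF
  have hF0 : 0 ≤ F := Real.sqrt_nonneg _
  have hF2 : F ^ 2 = ∫ x, ‖f x‖ ^ 2 := Real.sq_sqrt (integral_nonneg fun _ => by positivity)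
  have hm0 : 0 ≤ ∫ x, ‖u₀ x‖ ^ 2 := integral_nonneg fun _ => by positivity
  have hI0 : 0 ≤ I :=
    intervalIntegral.integral_nonneg zero_le_one fun t _ => integral_nonneg fun _ => by positivity
  rw [← hF2] at hI ⊢
  nlinarith [sq_nonneg (F - Real.sqrt I), Real.sq_sqrt hI0, Real.sqrt_nonneg I, sq_nonneg F]

end Path

section Law

variable {ν : ℝ} {f : UnitAddTorus (Fin 3) → EuclideanSpace ℝ (Fin 3)} {Ω : Type*} [MeasurableSpace Ω]
  {P : Measure Ω} {S : Ω → Ω} {traj : Ω → ℝ → UnitAddTorus (Fin 3) → EuclideanSpace ℝ (Fin 3)}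

/-! ### Integrability and means under the slice cap; the dissipation floor in Bochner form -/

variable {E δ : ℝ}

/-- Under the slice cap `∫⁻ ofReal ‖traj ω 0‖₂² dP ≤ ofReal E` the slice energy is integrable.
[folklore] -/
theorem integrable_normSq_zero (h : Torus.IsStationaryLerayHopfLaw ν f P S traj)
    (hcap : ∫⁻ ω, ENNReal.ofReal (∫ x, ‖traj ω 0 x‖ ^ 2) ∂P ≤ ENNReal.ofReal E) :
    Integrable (fun ω => ∫ x, ‖traj ω 0 x‖ ^ 2) P := by
  have hm := measurable_normSq_zero h
  have hi := integrable_toReal_of_lintegral_ne_top hm.ennreal_ofReal.aemeasurable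
    (ne_top_of_le_ne_top ENNReal.ofReal_ne_top hcap)
  refine hi.congr (ae_of_all _ fun ω => ?_)
  exact ENNReal.toReal_ofReal (integral_nonneg fun x => by positivity)

/-- … and its mean is `≤ max E 0`. [folklore] -/
theorem integral_normSq_zero_le (h : Torus.IsStationaryLerayHopfLaw ν f P S traj)
    (hcap : ∫⁻ ω, ENNReal.ofReal (∫ x, ‖traj ω 0 x‖ ^ 2) ∂P ≤ ENNReal.ofReal E) :
    ∫ ω, (∫ x, ‖traj ω 0 x‖ ^ 2) ∂P ≤ max E 0 := by
  have hm := measurable_normSq_zero h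
  rw [integral_eq_lintegral_of_nonneg_ae
    (ae_of_all _ fun ω => integral_nonneg fun x => by positivity) hm.aestronglyMeasurable]
  have := ENNReal.toReal_mono ENNReal.ofReal_ne_top hcap
  rwa [ENNReal.toReal_ofReal'] at this

/-- Under the slice cap the unit-window energy is integrable (`lhPath_windowEnergy_le`). [folklore] -/
theorem integrable_windowEnergy (h : Torus.IsStationaryLerayHopfLaw ν f P S traj) (hν : 0 < ν)
    (hf : IsSmooth f)
    (hcap : ∫⁻ ω, ENNReal.ofReal (∫ x, ‖traj ω 0 x‖ ^ 2) ∂P ≤ ENNReal.ofReal E) :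
    Integrable (fun ω => ∫ t in (0 : ℝ)..1, ∫ x, ‖traj ω t x‖ ^ 2) P := by
  haveI := h.isProbabilityMeasure
  have hm0 := integrable_normSq_zero h hcap
  refine Integrable.mono' ((hm0.const_mul 2).add (integrable_const (4 * ∫ x, ‖f x‖ ^ 2)))
    (aestronglyMeasurable_windowEnergy h) (ae_of_all _ fun ω => ?_)
  rw [Real.norm_eq_abs, abs_of_nonneg (intervalIntegral.integral_nonneg zero_le_one
    fun t _ => integral_nonneg fun x => by positivity)]
  exact lhPath_windowEnergy_le (h.isGlobalLerayHopf ω) hν.le hf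

/-- … with mean `≤ E₁ = 2 max(E,0) + 4‖f‖₂²`. [folklore] -/
theorem integral_windowEnergy_le (h : Torus.IsStationaryLerayHopfLaw ν f P S traj) (hν : 0 < ν)
    (hf : IsSmooth f)
    (hcap : ∫⁻ ω, ENNReal.ofReal (∫ x, ‖traj ω 0 x‖ ^ 2) ∂P ≤ ENNReal.ofReal E) :
    ∫ ω, (∫ t in (0 : ℝ)..1, ∫ x, ‖traj ω t x‖ ^ 2) ∂P ≤ 2 * max E 0 + 4 * ∫ x, ‖f x‖ ^ 2 := by
  haveI := h.isProbabilityMeasure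
  have hm0 := integrable_normSq_zero h hcap
  have heW := integrable_windowEnergy h hν hf hcap
  have hmean := integral_normSq_zero_le h hcap
  calc ∫ ω, (∫ t in (0 : ℝ)..1, ∫ x, ‖traj ω t x‖ ^ 2) ∂P
      ≤ ∫ ω, (2 * (∫ x, ‖traj ω 0 x‖ ^ 2) + 4 * ∫ x, ‖f x‖ ^ 2) ∂P :=
        integral_mono heW ((hm0.const_mul 2).add (integrable_const _))
          fun ω => lhPath_windowEnergy_le (h.isGlobalLerayHopf ω) hν.le hf
    _ = 2 * ∫ ω, (∫ x, ‖traj ω 0 x‖ ^ 2) ∂P + 4 * ∫ x, ‖f x‖ ^ 2 := by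
        rw [integral_add (hm0.const_mul 2) (integrable_const _), integral_const_mul, integral_const]
        simp
    _ ≤ 2 * max E 0 + 4 * ∫ x, ‖f x‖ ^ 2 := by linarith

/-- Under the slice cap the unit-window dissipation is integrable (`lhPath_windowDissipation_le`).
[folklore] -/
theorem integrable_windowDissipation (h : Torus.IsStationaryLerayHopfLaw ν f P S traj) (hν : 0 < ν)
    (hf : IsSmooth f)
    (hcap : ∫⁻ ω, ENNReal.ofReal (∫ x, ‖traj ω 0 x‖ ^ 2) ∂P ≤ ENNReal.ofReal E) :
    Integrable (fun ω => ∫ t in (0 : ℝ)..1, ν * (eGradNormSq (traj ω t)).toReal) P := by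
  haveI := h.isProbabilityMeasure
  have hm0 := integrable_normSq_zero h hcap
  refine Integrable.mono' ((hm0.const_mul 2).add (integrable_const (3 * ∫ x, ‖f x‖ ^ 2)))
    (measurable_windowDissipation h).aestronglyMeasurable (ae_of_all _ fun ω => ?_)
  rw [Real.norm_eq_abs, abs_of_nonneg (intervalIntegral.integral_nonneg zero_le_one
    fun t _ => mul_nonneg hν.le ENNReal.toReal_nonneg)]
  exact lhPath_windowDissipation_le (h.isGlobalLerayHopf ω) hν.le hf

/-- **The `ℝ≥0∞` dissipation floor in Bochner form**: if
`ofReal δ ≤ ofReal ν · ∫⁻ (∫⁻_{(0,1)} ‖∇ traj ω‖₂²) dP` and the Bochner unit-window dissipation is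
integrable, then its mean is `≥ δ` (pathwise `∫⁻_{(0,1)} ‖∇u‖₂² < ∞`,
`Torus.IsLerayHopfOn.lintegral_eGradNormSq_lt_top`). [folklore] -/
theorem le_integral_windowDissipation (h : Torus.IsStationaryLerayHopfLaw ν f P S traj) (hν : 0 < ν)
    (hdis : ENNReal.ofReal δ ≤
      ENNReal.ofReal ν * ∫⁻ ω, (∫⁻ s in Ioo (0 : ℝ) 1, eGradNormSq (traj ω s)) ∂P)
    (hint : Integrable (fun ω => ∫ t in (0 : ℝ)..1, ν * (eGradNormSq (traj ω t)).toReal) P) :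
    δ ≤ ∫ ω, (∫ t in (0 : ℝ)..1, ν * (eGradNormSq (traj ω t)).toReal) ∂P := by
  have hD := measurable_lintegral_eGradNormSq h
  have hnn : 0 ≤ᵐ[P] fun ω => ∫ t in (0 : ℝ)..1, ν * (eGradNormSq (traj ω t)).toReal :=
    ae_of_all _ fun ω => intervalIntegral.integral_nonneg zero_le_one
      fun t _ => mul_nonneg hν.le ENNReal.toReal_nonneg
  have hpt : ∀ ω, ENNReal.ofReal (∫ t in (0 : ℝ)..1, ν * (eGradNormSq (traj ω t)).toReal) =
      ENNReal.ofReal ν * ∫⁻ s in Ioo (0 : ℝ) 1, eGradNormSq (traj ω s) := by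
    intro ω
    rw [windowDissipation_eq (h.isGlobalLerayHopf ω), ENNReal.ofReal_mul hν.le,
      ENNReal.ofReal_toReal ((h.isGlobalLerayHopf ω 1 one_pos).lintegral_eGradNormSq_lt_top).ne]
  have hrw : ∫⁻ ω, ENNReal.ofReal (∫ t in (0 : ℝ)..1, ν * (eGradNormSq (traj ω t)).toReal) ∂P =
      ENNReal.ofReal ν * ∫⁻ ω, (∫⁻ s in Ioo (0 : ℝ) 1, eGradNormSq (traj ω s)) ∂P := by
    rw [← lintegral_const_mul _ hD]
    exact lintegral_congr fun ω => hpt ω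
  have hlt : ∫⁻ ω, ENNReal.ofReal (∫ t in (0 : ℝ)..1, ν * (eGradNormSq (traj ω t)).toReal) ∂P < ∞ :=
    (hasFiniteIntegral_iff_ofReal hnn).1 hint.hasFiniteIntegral
  rw [integral_eq_lintegral_of_nonneg_ae hnn hint.aestronglyMeasurable]
  change δ ≤ (∫⁻ ω, ENNReal.ofReal (∫ t in (0 : ℝ)..1, ν * (eGradNormSq (traj ω t)).toReal) ∂P).toReal
  rw [hrw] at hlt ⊢
  calc δ ≤ (ENNReal.ofReal δ).toReal := by rw [ENNReal.toReal_ofReal']; exact le_max_left _ _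
    _ ≤ _ := ENNReal.toReal_mono hlt.ne hdis

end Law

end LawRealisation

/-! ### The crux, by name -/

open LawRealisation in
/-- **`LawRealisation` holds** (route `LoudWindows`, item stmt-AnomalousDissipation-26823): constants
`C = 16‖f‖₂² E₁²/δ²`, `E₁ = 2 max(E,0) + 4‖f‖₂²`, `δ' = δ/2`; engine
`exists_witnessPath_of_meanEnsemble`, fed by the law-format dictionary of this file.
[folklore] [cite: FoiasManleyRosaTemam2001, Ch. IV §3] [cite: DoeringFoias2002, §2] -/
theorem loudWindows_lawRealisation :
    Summit.AnomalousDissipation.AnomalousDissipation.Theses.LoudWindows.LawRealisation := by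
  intro f hf hfdiv hf0 E δ hδ
  refine ⟨16 * (∫ x, ‖f x‖ ^ 2) * (2 * max E 0 + 4 * ∫ x, ‖f x‖ ^ 2) ^ 2 / δ ^ 2, δ / 2,
    by positivity, ?_⟩
  intro ν hν Ω _ P S traj hlaw hcap hdis
  haveI := hlaw.isProbabilityMeasure
  have hEint := integrable_windowEnergy hlaw hν hf hcap
  have hEle := integral_windowEnergy_le hlaw hν hf hcap
  have hDint := integrable_windowDissipation hlaw hν hf hcap
  have hDge := le_integral_windowDissipation hlaw hν hdis hDint
  obtain ⟨ω, h1, h2⟩ := exists_witnessPath_of_meanEnsemble hlaw.measurePreserving hν.le hf hδ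
    hlaw.isGlobalLerayHopf hlaw.shift hEint hEle hDint hDge
  exact ⟨ω, h1, h2⟩

/-- The same crux under its `LionsToll` name (item shared by the two routes; the two route decls are
character-for-character identical). [folklore] -/
theorem lionsToll_lawRealisation :
    Summit.AnomalousDissipation.AnomalousDissipation.Theses.LionsToll.LawRealisation :=
  loudWindows_lawRealisation

end Summit.AnomalousDissipation.AnomalousDissipation.Theorems

end
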